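import Summits.QuantumFields.BalabanUV.T4Continuum.Support.NE3CovariantBlockMean
import Summits.QuantumFields.BalabanUV.T4Continuum.Support.NE3LandauOrbit
import HarnessLib

/-!
# NE3CurvedFrameKill (T⁴ programme, node NE3, row K0a of the owner's ruling ρ-g22-2, file 2∕2) — EVERY k-FOLD DIRECTION AT A
# SMALL-FIELD BACKGROUND IS GAUGE-EQUIVALENT, BY A GAUGE VANISHING ON THE `L`-LATTICE, TO A FRAME-FREE ONE:
# `framePotW L k W (Y + gaugeDir W μ) = 0` — EXACTLY, with tangency unchanged

NE3 (node U1b) formalisation swarm `b2b-balaban-t4-ne3-formalise-*`, leaf seat `b2b-balaban-t4-ne3-formalise-leaf-02` (gen 5), row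
**K0a** (INTENT `HOME/CLAIMS.log` 2026-08-20T16:48Z); file 1 = `NE3CovariantBlockMean` (the curved (‡) and the lift).  All [folklore],
0 sorry, 0 def; the multi-level small-field class is that of `NE3TangentCovariantTower.dirIter_gaugeDir` throughout (unitary `W` of
period `tower L M (j+1)`, `0 ≤ x`, `LevelSmall d L j x`, `SmallField W x`):
§5 `pow_succ_mul_eq_tower`; **`framePotW_add`** (additivity of the accumulated frames: `Fbar_add` ∕ `Qbar_add` per level),
   **`framePotW_skew_periodic`** (for skew `tower`-periodic `Y`: `framePotW L (j+1) W Y` is skew and `M`-periodic — `Fbar_skew` ∕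
   `Qbar_skew` ∕ `Fbar_add_period` ∕ `Qbar_add_period` per level);
§6 **`exists_bmeanIterW_eq`** — THE NESTED TRANSPORTED BLOCK MEAN IS ONTO (`L^d ≥ 2`): every skew `M`-periodic coarse `θ` is
   `bmeanIterW L (j+1) W μ` for a skew `(tower L M (j+1))`-periodic `μ` VANISHING ON `L•ℤ^d` (induction down the tower with file 1's
   `liftW` ∕ `bmeanW_liftW`; only the unitarity of the averaged backgrounds is used);
§7 **`exists_frameFreeW_repr`** — THE CURVED FRAME-KILL: every skew `(tower L M (j+1))`-periodic `Y` has a skew, periodic `μ` with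
   `μ (L•w) = 0` (so `μ ((L^(j+1))•w) = 0`: corner-trivial at every level) such that
   `framePotW L (j+1) W (fun y ν => Y y ν + gaugeDir W μ y ν) = 0`, the moved field is skew and periodic, and
   `TangentIter L j W (Y + gaugeDir W μ) ↔ TangentIter L j W Y` (leaf-04's `tangentIter_add_gaugeDir_iff`) — `θ := framePotW L (j+1) W Y`,
   `μ` from §6, then `framePotW (Y + gaugeDir W μ) = θ + (μ∘corner − bmeanIterW μ) = θ + 0 − θ = 0` by `framePotW_add` and the curved
   (‡) `framePotW_gaugeDir`.
WHY (honest).  This is the first input of row K0's Φ6-W on the owner's slice of record `T_♮(W)` (ρ-g22-2 (V3)) — the half that the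
projected-Landau twin `T_pt(W)` (leaf-01-g5, INTENT 16:41Z) does not need — and of S3's «`ψ′ = −bmean_W ζ′`, NO frame potential»; the
rest of K0 (the Set `frameFreeBlockLandauW`, `Ξ₀₀(W) := {corner-trivial, bmeanIterW = 0}`, orthogonality ⟺ covariantly
blockwise-constant `covDiv` off corners, the projection) follows over leaf-01-g5's curved Gram kit.  Nothing about Bałaban's minimisers;
(P♮)_W, (ML_w) at `W ≠ 1`, T-E_w and NE3 are NOT proved; spine PROVED 0∕9; finite T⁴ rung (B)+1 — NOT infinite volume, NOT mass gap,
NOT BetaPertH, NOT Clay.  ABSOLUTE RULE kept (context only: [Balaban1985Averaging] (42)–(48) pp. 23–25, (110)–(125) pp. 31–36;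
[Balaban1985Variational] (83) p. 290).  PLACEMENT: `Summits/QuantumFields/BalabanUV/`; imports file 1 and leaf-04's `NE3LandauOrbit`
(`gaugeDir_skew`) BY NAME; moves nothing.  HONEST DEPENDENCY: continuum YM on T⁴ ⇐ BetaPertH ∧ nine spine estimates (0/9 proved);
BetaPertH ⇐ (D1) ∧ (D4) ∧ CAP+tail; G-an2-4 gates asym, D1 and NE2/3/4.
-/

set_option autoImplicit false

open scoped BigOperators Matrix.Norms.L2Operator
open Finset

namespace Summit.QuantumFields.BalabanUV.T4Continuum.NE3CurvedFrameKill

open Literature.MathematicalPhysics.QuantumFieldTheory.Balaban1983to89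
open B7Prop1Explicit B7Prop2Explicit
open T4AveragingDeficitWall (IsUnitaryCfg IsSkewDir SmallField Ad)
open T4AveragingDeficitWallBoundary (IsPeriodicCfg)
open AveragingDeficitPeriodicCounting (IsPeriodicDir)
open AveragingDeficitChartCalculus (cavg)
open AveragingDeficitMultiLevelPrep (cavgIter TangentIter tower LevelSmall natCast_tower_succ tower_ne_zero)
open AveragingDeficitFermat (isPeriodicCfg_cavg)
open BlockAveragePushDirGauge (gaugeDir isPeriodicDir_gaugeDir)
open NE3TangentCovariantStructure (Qbar Fbar Fbar_add Qbar_add Fbar_skew Qbar_skew Fbar_add_period Qbar_add_period)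
open NE3TangentCovariantTower (framePotW framePotW_one framePotW_succ step_small tangentIter_add_gaugeDir_iff)
open NE3LandauOrbit (gaugeDir_skew)
open NE3CovariantBlockMean (bmeanW bmeanIterW bmeanIterW_zero bmeanIterW_succ bmeanW_mem_skewAdjoint bmeanW_add_period
  bmeanIterW_skew_periodic framePotW_gaugeDir liftW liftW_corner liftW_mem_skewAdjoint liftW_add_period bmeanW_liftW)

noncomputable section

variable {d : ℕ} {n : Type*} [Fintype n] [DecidableEq n] [Nonempty n]

/-! ## §5 The accumulated frames in the class: additivity, skewness, periodicity -/

omit [Fintype n] [DecidableEq n] [Nonempty n] in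
/-- `L^(j+1)·M = tower L M (j+1)` (cast to `ℤ`). [folklore] -/
theorem pow_succ_mul_eq_tower (L M : ℕ) : ∀ j : ℕ, ((L : ℤ) ^ (j + 1) * (M : ℤ)) = ((tower L M (j + 1) : ℕ) : ℤ)
  | 0 => by simp [tower]
  | j + 1 => by rw [natCast_tower_succ, ← pow_succ_mul_eq_tower L M j]; ring

/-- **ADDITIVITY OF THE ACCUMULATED FRAMES** in the multi-level small-field class (unitary `W`, `0 ≤ x`, `LevelSmall d L j x`,
`SmallField W x`): `framePotW L (j+1) W (A + B) z = framePotW L (j+1) W A z + framePotW L (j+1) W B z` (`Fbar_add`, `Qbar_add` at each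
level). [folklore] -/
theorem framePotW_add {L : ℕ} (hL : 1 ≤ L) (j : ℕ) :
    ∀ {W : Site d → Fin d → (Matrix n n ℂ)ˣ} {x : ℝ}, IsUnitaryCfg W → 0 ≤ x → LevelSmall d L j x → SmallField W x →
    ∀ (A B : Site d → Fin d → (Matrix n n ℂ)) (z : Site d),
      framePotW L (j + 1) W (fun y ν => A y ν + B y ν) z = framePotW L (j + 1) W A z + framePotW L (j + 1) W B z := by
  induction j with
  | zero =>
      intro W x _ _ _ _ A B z
      rw [zero_add, framePotW_one, framePotW_one, framePotW_one, Fbar_add]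
  | succ j ih =>
      intro W x hWu hx hs hWx A B z
      obtain ⟨h512, hW₁u, hr0, hW₁x⟩ := step_small hL hWu hx hs.1 hWx
      have hrec : ∀ Y : Site d → Fin d → (Matrix n n ℂ), framePotW L (j + 1 + 1) W Y z
          = framePotW L (j + 1) (cavg L W) (Qbar L W Y) z + Fbar L W Y (((L : ℤ) ^ (j + 1)) • z) := by
        intro Y; rw [framePotW_succ]
      rw [hrec, hrec, hrec, Qbar_add hL hWu hx h512 hWx A B, ih hW₁u hr0 hs.2 hW₁x, Fbar_add]
      abel

/-- **SKEWNESS AND PERIODICITY OF THE ACCUMULATED FRAMES** in the class (unitary `W` of period `tower L M (j+1)`): for a skew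
`(tower L M (j+1))`-periodic `Y`, `framePotW L (j+1) W Y` is skew and `M`-periodic. [folklore] -/
theorem framePotW_skew_periodic {L M : ℕ} [NeZero M] (hL : 1 ≤ L) (j : ℕ) :
    ∀ {W : Site d → Fin d → (Matrix n n ℂ)ˣ} {x : ℝ}, IsUnitaryCfg W → IsPeriodicCfg W ((tower L M (j + 1) : ℕ) : ℤ) → 0 ≤ x →
    LevelSmall d L j x → SmallField W x → ∀ {Y : Site d → Fin d → (Matrix n n ℂ)}, IsSkewDir Y →
    IsPeriodicDir Y ((tower L M (j + 1) : ℕ) : ℤ) →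
      (∀ z, framePotW L (j + 1) W Y z ∈ skewAdjoint (Matrix n n ℂ)) ∧
        ∀ (z : Site d) (i : Fin d), framePotW L (j + 1) W Y (z + (M : ℤ) • e i) = framePotW L (j + 1) W Y z := by
  induction j with
  | zero =>
      intro W x hWu hWP _ _ _ Y hY hYP
      have hWP' : IsPeriodicCfg W ((L : ℤ) * (tower L M 0 : ℕ)) := by rw [← natCast_tower_succ]; exact hWP
      have hYP' : IsPeriodicDir Y ((L : ℤ) * (tower L M 0 : ℕ)) := by rw [← natCast_tower_succ]; exact hYP
      rw [zero_add, framePotW_one]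
      refine ⟨fun z => Fbar_skew L hWu hY z, fun z i => ?_⟩
      have h := Fbar_add_period L hWP' hYP' z i
      simpa [tower] using h
  | succ j ih =>
      intro W x hWu hWP hx hs hWx Y hY hYP
      obtain ⟨h512, hW₁u, hr0, hW₁x⟩ := step_small hL hWu hx hs.1 hWx
      have hWP' : IsPeriodicCfg W ((L : ℤ) * (tower L M (j + 1) : ℕ)) := by rw [← natCast_tower_succ]; exact hWP
      have hYP' : IsPeriodicDir Y ((L : ℤ) * (tower L M (j + 1) : ℕ)) := by rw [← natCast_tower_succ]; exact hYP
      have hW₁P : IsPeriodicCfg (cavg L W) ((tower L M (j + 1) : ℕ) : ℤ) := isPeriodicCfg_cavg L _ hWP'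
      have hQs : IsSkewDir (Qbar L W Y) := Qbar_skew hL hWu hx h512 hWx hY
      have hQP : IsPeriodicDir (Qbar L W Y) ((tower L M (j + 1) : ℕ) : ℤ) := fun z i κ => Qbar_add_period L hWP' hYP' z i κ
      obtain ⟨ihs, ihP⟩ := ih hW₁u hW₁P hr0 hs.2 hW₁x hQs hQP
      have hrec : ∀ z : Site d, framePotW L (j + 1 + 1) W Y z
          = framePotW L (j + 1) (cavg L W) (Qbar L W Y) z + Fbar L W Y (((L : ℤ) ^ (j + 1)) • z) := by
        intro z; rw [framePotW_succ]
      -- `Y` is `(L · (L^j·(L·M)))`-periodic in the form `Fbar_add_period` wants at the point `L^(j+1)•z`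
      have hM' : ((L : ℤ) ^ (j + 1) * (M : ℤ)) = ((tower L M (j + 1) : ℕ) : ℤ) := pow_succ_mul_eq_tower L M j
      refine ⟨fun z => ?_, fun z i => ?_⟩
      · rw [hrec]
        exact (skewAdjoint (Matrix n n ℂ)).add_mem (ihs z) (Fbar_skew L hWu hY _)
      · rw [hrec, hrec, ihP z i, smul_add, smul_smul, hM']
        have hF := Fbar_add_period L (P := ((tower L M (j + 1) : ℕ) : ℤ)) hWP' hYP' (((L : ℤ) ^ (j + 1)) • z) i
        rw [hF]

/-! ## §6 The nested block mean is ONTO, with a lift vanishing on the `L`-lattice -/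

/-- **EVERY COARSE 𝔲(n)-VALUED FIELD IS THE NESTED TRANSPORTED BLOCK MEAN OF A FIELD VANISHING ON `L•ℤ^d`** (class as above,
`L^d ≥ 2`): for a skew `M`-periodic `θ` there is a skew `(tower L M (j+1))`-periodic `μ` with `μ (L•w) = 0` for all `w` (hence
corner-trivial at every level) and `bmeanIterW L (j+1) W μ = θ` — induction down the tower with the transported corner gauge
`liftW` (`bmeanW_liftW`); no smallness is used beyond the unitarity of the averaged backgrounds. [folklore] -/
theorem exists_bmeanIterW_eq {L M : ℕ} [NeZero M] (hL : 1 ≤ L) (hLd : 2 ≤ L ^ d) (j : ℕ) :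
    ∀ {W : Site d → Fin d → (Matrix n n ℂ)ˣ} {x : ℝ}, IsUnitaryCfg W → IsPeriodicCfg W ((tower L M (j + 1) : ℕ) : ℤ) → 0 ≤ x →
    LevelSmall d L j x → SmallField W x → ∀ {θ : Site d → (Matrix n n ℂ)}, (∀ z, θ z ∈ skewAdjoint (Matrix n n ℂ)) →
    (∀ (z : Site d) (i : Fin d), θ (z + (M : ℤ) • e i) = θ z) →
      ∃ mu : Site d → (Matrix n n ℂ), (∀ y, mu y ∈ skewAdjoint (Matrix n n ℂ)) ∧
        (∀ (y : Site d) (i : Fin d), mu (y + ((tower L M (j + 1) : ℕ) : ℤ) • e i) = mu y) ∧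
        (∀ w : Site d, mu ((L : ℤ) • w) = 0) ∧ bmeanIterW L (j + 1) W mu = θ := by
  induction j with
  | zero =>
      intro W x hWu hWP _ _ _ θ hθ hθP
      have hWP' : IsPeriodicCfg W ((L : ℤ) * (M : ℤ)) := by
        have : ((tower L M (0 + 1) : ℕ) : ℤ) = (L : ℤ) * (M : ℤ) := by rw [natCast_tower_succ]; simp [tower]
        rw [← this]; exact hWP
      refine ⟨liftW L W θ, liftW_mem_skewAdjoint L hWu hθ, fun y i => ?_, liftW_corner L hL W θ, ?_⟩
      · have : ((tower L M (0 + 1) : ℕ) : ℤ) = (L : ℤ) * (M : ℤ) := by rw [natCast_tower_succ]; simp [tower]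
        rw [this]; exact liftW_add_period hL hWP' hθP y i
      · rw [zero_add, bmeanIterW_succ, bmeanIterW_zero, bmeanW_liftW hL hLd]
  | succ j ih =>
      intro W x hWu hWP hx hs hWx θ hθ hθP
      obtain ⟨h512, hW₁u, hr0, hW₁x⟩ := step_small hL hWu hx hs.1 hWx
      have hWP' : IsPeriodicCfg W ((L : ℤ) * (tower L M (j + 1) : ℕ)) := by rw [← natCast_tower_succ]; exact hWP
      have hW₁P : IsPeriodicCfg (cavg L W) ((tower L M (j + 1) : ℕ) : ℤ) := isPeriodicCfg_cavg L _ hWP'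
      obtain ⟨mu₁, hmu₁s, hmu₁P, -, hmu₁⟩ := ih hW₁u hW₁P hr0 hs.2 hW₁x hθ hθP
      refine ⟨liftW L W mu₁, liftW_mem_skewAdjoint L hWu hmu₁s, fun y i => ?_, liftW_corner L hL W mu₁, ?_⟩
      · rw [natCast_tower_succ]; exact liftW_add_period hL hWP' hmu₁P y i
      · rw [bmeanIterW_succ, bmeanW_liftW hL hLd, hmu₁]

/-! ## §7 THE CURVED FRAME-KILL -/

/-- **THE CURVED FRAME-KILL, EXACT.**  In the multi-level small-field class of `NE3TangentCovariantTower.dirIter_gaugeDir` (unitary `W`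
of period `tower L M (j+1)`, `0 ≤ x`, `LevelSmall d L j x`, `SmallField W x`; `L^d ≥ 2`), every skew `(tower L M (j+1))`-periodic
direction `Y` has a skew, `(tower L M (j+1))`-periodic gauge generator `μ` VANISHING ON `L•ℤ^d` (so corner-trivial at every level,
in particular `μ ((L^(j+1))•w) = 0`) such that the gauge-moved direction `Y + gaugeDir W μ` is FRAME-FREE:
`framePotW L (j+1) W (Y + gaugeDir W μ) = 0`; and tangency is unchanged (`tangentIter_add_gaugeDir_iff`).  The T_♮(W) analogue of
Φ1a's `NE3FramePotGauge.exists_frameFree_repr`; mechanism: the curved (‡) `framePotW_gaugeDir` + the onto-ness of the nested block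
mean `exists_bmeanIterW_eq` applied to `θ := framePotW L (j+1) W Y`. [folklore] -/
theorem exists_frameFreeW_repr {L M : ℕ} [NeZero M] (hL : 1 ≤ L) (hLd : 2 ≤ L ^ d) (j : ℕ)
    {W : Site d → Fin d → (Matrix n n ℂ)ˣ} {x : ℝ} (hWu : IsUnitaryCfg W) (hWP : IsPeriodicCfg W ((tower L M (j + 1) : ℕ) : ℤ))
    (hx : 0 ≤ x) (hs : LevelSmall d L j x) (hWx : SmallField W x)
    {Y : Site d → Fin d → (Matrix n n ℂ)} (hY : IsSkewDir Y) (hYP : IsPeriodicDir Y ((tower L M (j + 1) : ℕ) : ℤ)) :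
    ∃ mu : Site d → (Matrix n n ℂ), (∀ y, mu y ∈ skewAdjoint (Matrix n n ℂ))
      ∧ (∀ (y : Site d) (i : Fin d), mu (y + ((tower L M (j + 1) : ℕ) : ℤ) • e i) = mu y)
      ∧ (∀ w : Site d, mu ((L : ℤ) • w) = 0)
      ∧ (∀ w : Site d, mu (((L : ℤ) ^ (j + 1)) • w) = 0)
      ∧ (∀ z : Site d, framePotW L (j + 1) W (fun y ν => Y y ν + gaugeDir W mu y ν) z = 0)
      ∧ IsSkewDir (fun y ν => Y y ν + gaugeDir W mu y ν)
      ∧ IsPeriodicDir (fun y ν => Y y ν + gaugeDir W mu y ν) ((tower L M (j + 1) : ℕ) : ℤ)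
      ∧ (TangentIter L j W (fun y ν => Y y ν + gaugeDir W mu y ν) ↔ TangentIter L j W Y) := by
  obtain ⟨hθs, hθP⟩ := framePotW_skew_periodic hL j hWu hWP hx hs hWx hY hYP
  obtain ⟨mu, hmus, hmuP, hmu0, hmuθ⟩ := exists_bmeanIterW_eq hL hLd j hWu hWP hx hs hWx hθs hθP
  have hmu0' : ∀ w : Site d, mu (((L : ℤ) ^ (j + 1)) • w) = 0 := by
    intro w; rw [pow_succ', mul_smul]; exact hmu0 _
  refine ⟨mu, hmus, hmuP, hmu0, hmu0', fun z => ?_, ?_, ?_, ?_⟩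
  · rw [framePotW_add hL j hWu hx hs hWx Y (gaugeDir W mu) z, framePotW_gaugeDir hL j hWu hWP hx hs hWx hmus hmuP z, hmuθ,
      hmu0' z]
    abel
  · exact fun y ν => (skewAdjoint (Matrix n n ℂ)).add_mem (hY y ν) (gaugeDir_skew hWu hmus y ν)
  · intro y i ν
    simp only [hYP y i ν, isPeriodicDir_gaugeDir hWP hmuP y i ν]
  · exact tangentIter_add_gaugeDir_iff (M := M) hL j hWu hWP hx hs hWx Y hmus hmuP hmu0'

end

end Summit.QuantumFields.BalabanUV.T4Continuum.NE3CurvedFrameKill
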